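import Mathlib
import HarnessLib.Audit
import Summits.PneNP.PneNP.Theorems.PstarChordBridgeLift
import Summits.PneNP.PneNP.Theorems.PstarChordBridgeTerminal
import Summits.PneNP.PneNP.Theorems.PstarChordBridgeCotree
import Summits.PneNP.PneNP.Theorems.PstarChordBridgeJoin

/-!
# Assembling bridge data for a terminal core under Assumption A (ROUND-24, memo §9 R1; GAPTWO-PLAN S4)

FRONTIER range-avoidance ladder, rung F-N3, ROUND 24 (cell `pnp-ideate`, planner memo `r24/CORE-BOUND-NOTES.md` §2 (Assumption A: "take a spanning
forest `F ⊇ {centre edges}`; co-tree `N ⊆ {clean edges}`"), §9 R1, §11 (N3); restricted-model proof complexity — nothing here bears on `P` versus `NP`).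

This file COMPOSES the structural existence results into the data `PstarChordBridge` consumes.  Given a non-empty XOR-closed core `J₀` of a pure
typed `(r,3/2)`-expanding instance with simple overlaps (`#J₀ ≤ r`), two G-constraints with monomials off `J₀`, (T3) and (M0), and a MAXIMAL peelable
(= forest) `F ⊆ J₀` (`PstarChordBridgeCotree.exists_maximal_peelable`), under the two CASE HYPOTHESES

* Assumption A: every co-tree output `e ∈ J₀ ∖ F` is a chord of `J₀` (`IsChord`: both AND variables private inside `J₀`), and
* no CROSS pendant: no monomial of the constraints has both AND variables among the chord privates,

`exists_bridgeData` produces bridge data `B` with `B.J₀ = J₀`, `B.N = J₀ ∖ F`, the given constraints, well-formed (`WF`: fundamental sets from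
`PstarChordBridgeCotree.exists_fundamental_of_maximal`, joins from `PstarChordBridgeJoin.exists_join_of_terminal` via the chains
`ends_connected_of_even`), with the lift property (`PstarChordBridgeLift`), and whose chord system is INFEASIBLE and CHORD-MINIMAL in every chord.
So the model layer and `PstarChordBridgeForcing` / `…Collapse` / `…Basis` apply to every such core with no further data.

Also here (moved up from the NOR analysis so that the join construction can use them): `ends_connected_of_odd` / `ends_connected_of_even` — the
XOR ends of a chord are joined by a chain of outputs of its fundamental set (path-free ⟹ `Relation.ReflTransGen`).
-/

set_option linter.dupNamespace false -- `Summit.PneNP.PneNP.…`: summit = sub-problem name (D-0017 single-conjunct layout)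

open Finset Literature.Computability.Complexity
open Summit.PneNP.PneNP.Theorems.PstarTyped (Typed)
open Summit.PneNP.PneNP.Theorems.PstarSALevel (varSet bdry BoundaryExpanding SimpleOverlap)
open Summit.PneNP.PneNP.Theorems.PstarCoreBound (XorClosed)
open Summit.PneNP.PneNP.Theorems.PstarGapOneAll (gval)
open Summit.PneNP.PneNP.Theorems.PstarXorElimination (pdeg)
open Summit.PneNP.PneNP.Theorems.PstarXCore (xpair xverts mem_xpair)
open Summit.PneNP.PneNP.Theorems.PstarChordRepair (IsChord)
open Summit.PneNP.PneNP.Theorems.PstarChordSystem (ChordSystem)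
open Summit.PneNP.PneNP.Theorems.PstarChordBridgeTools
open Summit.PneNP.PneNP.Theorems.PstarChordBridge
open Summit.PneNP.PneNP.Theorems.PstarChordBridgeLift (lift_of_wf_peelable)
open Summit.PneNP.PneNP.Theorems.PstarChordBridgeTerminal (HasConstraints)
open Summit.PneNP.PneNP.Theorems.PstarChordBridgeFundamental (xpdeg_insert odd_of_end mem_xpair_of_odd exists_mem_of_odd)
open Summit.PneNP.PneNP.Theorems.PstarChordBridgeCotree (Peelable exists_fundamental_of_maximal)
open Summit.PneNP.PneNP.Theorems.PstarChordBridgeJoin (exists_join_of_terminal)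

namespace Summit.PneNP.PneNP.Theorems.PstarChordBridgeAssemble

variable {n m : ℕ}

/-! ## From parities to chains -/

/-- Chains along a sub-family are chains along the family. -/
theorem reflTransGen_mono (I : LocalMap 4 n m) {D D' : Finset (Fin m)} (h : D' ⊆ D) {x y : Fin n}
    (hr : Relation.ReflTransGen (fun x y => ∃ j ∈ D', x ∈ xpair I j ∧ y ∈ xpair I j) x y) :
    Relation.ReflTransGen (fun x y => ∃ j ∈ D, x ∈ xpair I j ∧ y ∈ xpair I j) x y := by
  induction hr with
  | refl => exact Relation.ReflTransGen.refl
  | tail _ hst ih =>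
    obtain ⟨j', hj', hx, hy⟩ := hst
    exact ih.tail ⟨j', h hj', hx, hy⟩

/-- Chains can carry any property shared by all outputs of the family. -/
theorem reflTransGen_of_forall (I : LocalMap 4 n m) {D : Finset (Fin m)} {P : Fin m → Prop} (hP : ∀ j ∈ D, P j) {x y : Fin n}
    (hr : Relation.ReflTransGen (fun x y => ∃ j ∈ D, x ∈ xpair I j ∧ y ∈ xpair I j) x y) :
    Relation.ReflTransGen (fun x y => ∃ j ∈ D, P j ∧ x ∈ xpair I j ∧ y ∈ xpair I j) x y := by
  induction hr with
  | refl => exact Relation.ReflTransGen.refl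
  | tail _ hst ih =>
    obtain ⟨j', hj', hx, hy⟩ := hst
    exact ih.tail ⟨j', hj', hP j' hj', hx, hy⟩

/-- **Odd vertices are joined.**  If the vertices of odd slot-degree of `D` are exactly `u` and `v` (`u ≠ v`), then `u` and `v` are joined by a
chain of outputs of `D` (pure instance: no output reads one variable in both XOR slots). -/
theorem ends_connected_of_odd (I : LocalMap 4 n m) (hI : I.IsPure xorAndPred) :
    ∀ (D : Finset (Fin m)) (u v : Fin n), u ≠ v → (∀ w, Odd (xpdeg I D w) ↔ (w = u ∨ w = v)) →
      Relation.ReflTransGen (fun x y => ∃ j ∈ D, x ∈ xpair I j ∧ y ∈ xpair I j) u v := by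
  classical
  intro D
  induction D using Finset.strongInduction with
  | H D ih =>
    intro u v huv hodd
    -- an output `j ∈ D` at `u`, with other end `w`
    obtain ⟨j, hj, hju⟩ := exists_mem_of_odd I ((hodd u).2 (Or.inl rfl))
    have h01 : I.vars j 0 ≠ I.vars j 1 := fun h => absurd (hI.2 j h) (by decide)
    obtain ⟨w, hw, hwu, hpair⟩ : ∃ w, w ∈ xpair I j ∧ w ≠ u ∧ ∀ x, x ∈ xpair I j ↔ (x = u ∨ x = w) := by
      rcases (mem_xpair I).1 hju with rfl | rfl
      · exact ⟨I.vars j 1, (mem_xpair I).2 (Or.inr rfl), h01.symm, fun x => mem_xpair I⟩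
      · exact ⟨I.vars j 0, (mem_xpair I).2 (Or.inl rfl), h01, fun x => by rw [mem_xpair]; tauto⟩
    have hstep : Relation.ReflTransGen (fun x y => ∃ j ∈ D, x ∈ xpair I j ∧ y ∈ xpair I j) u w :=
      Relation.ReflTransGen.single ⟨j, hj, hju, hw⟩
    by_cases hwv : w = v
    · rw [hwv] at hstep; exact hstep
    -- remove `j`: the odd vertices of `D - j` are `w` and `v`
    have hD' : D.erase j ⊂ D := erase_ssubset hj
    have hjD' : j ∉ D.erase j := fun h => (mem_erase.1 h).1 rfl
    have hins : insert j (D.erase j) = D := insert_erase hj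
    have hι : ∀ x, (if I.vars j 0 = x then 1 else 0) + (if I.vars j 1 = x then 1 else 0) = if x ∈ xpair I j then 1 else 0 := by
      intro x
      by_cases h0 : I.vars j 0 = x <;> by_cases h1 : I.vars j 1 = x
      · exact absurd (h0.trans h1.symm) h01
      · rw [if_pos h0, if_neg h1, if_pos ((mem_xpair I).2 (Or.inl h0.symm))]
      · rw [if_neg h0, if_pos h1, if_pos ((mem_xpair I).2 (Or.inr h1.symm))]
      · rw [if_neg h0, if_neg h1, if_neg (fun h => by rcases (mem_xpair I).1 h with h | h <;> simp_all)]
    have hodd' : ∀ x, Odd (xpdeg I (D.erase j) x) ↔ (x = w ∨ x = v) := by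
      intro x
      have hx := hodd x
      rw [← hins, xpdeg_insert I hjD', add_assoc, hι x] at hx
      by_cases hxj : x ∈ xpair I j
      · rw [if_pos hxj] at hx
        rcases (hpair x).1 hxj with rfl | rfl
        · -- `x = u`: odd in `D`, hence even in `D - j`
          have h1 : Odd (xpdeg I (D.erase j) x + 1) := hx.2 (Or.inl rfl)
          constructor
          · intro h2
            exact absurd h2.add_one (Nat.not_even_iff_odd.2 h1)
          · rintro (h | h)
            · exact absurd h hwu.symm
            · exact absurd h huv
        · -- `x = w`: even in `D`, hence odd in `D - j`
          have h1 : ¬ Odd (xpdeg I (D.erase j) x + 1) := fun h => by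
            rcases hx.1 h with h' | h'
            · exact hwu h'
            · exact hwv h'
          constructor
          · intro _; exact Or.inl rfl
          · intro _
            rw [Nat.not_odd_iff_even, Nat.even_add_one, Nat.not_even_iff_odd] at h1
            exact h1
      · rw [if_neg hxj, add_zero] at hx
        have hxu : x ≠ u := fun h => hxj ((hpair x).2 (Or.inl h))
        have hxw : x ≠ w := fun h => hxj ((hpair x).2 (Or.inr h))
        rw [hx]
        constructor
        · rintro (h | h)
          · exact absurd h hxu
          · exact Or.inr h
        · rintro (h | h)
          · exact absurd h hxw
          · exact Or.inr h
    have hrest := ih (D.erase j) hD' w v hwv hodd'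
    have hmono : Relation.ReflTransGen (fun x y => ∃ j ∈ D, x ∈ xpair I j ∧ y ∈ xpair I j) w v :=
      reflTransGen_mono I (erase_subset j D) hrest
    exact hstep.trans hmono

/-- **The XOR ends of a chord are joined inside its fundamental set** (`D + e` everywhere even, `e ∉ D`). -/
theorem ends_connected_of_even (I : LocalMap 4 n m) (hI : I.IsPure xorAndPred) {D : Finset (Fin m)} {e : Fin m} (he : e ∉ D)
    (heven : ∀ w, Even (xpdeg I (insert e D) w)) :
    Relation.ReflTransGen (fun x y => ∃ j ∈ D, x ∈ xpair I j ∧ y ∈ xpair I j) (I.vars e 0) (I.vars e 1) := by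
  have h01 : I.vars e 0 ≠ I.vars e 1 := fun h => absurd (hI.2 e h) (by decide)
  refine ends_connected_of_odd I hI D _ _ h01 fun w => ⟨fun hw => (mem_xpair I).1 (mem_xpair_of_odd I he heven hw), ?_⟩
  rintro (rfl | rfl)
  · exact odd_of_end I hI he heven (s := 0) (by decide)
  · exact odd_of_end I hI he heven (s := 1) (by decide)

/-! ## The assembly -/

/-- **Bridge data for a terminal core under Assumption A.**  See the module docstring (XOR-closedness of `J₀` is not needed for the construction;
it only guarantees `J₀ ∖ F ≠ ∅`, `PstarChordBridgeCotree.sdiff_nonempty_of_xorClosed`). -/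
theorem exists_bridgeData (I : LocalMap 4 n m) (hI : I.IsPure xorAndPred) (hT : Typed I) (hS : SimpleOverlap I) {r : ℕ}
    (hB : BoundaryExpanding r I) (y : Fin m → Bool) {J₀ : Finset (Fin m)} (hne : J₀.Nonempty) (hr : J₀.card ≤ r)
    (w₁ w₂ : Finset (Fin n) × Finset (Fin m) × Bool) (hG₁ : Disjoint J₀ w₁.2.1) (hG₂ : Disjoint J₀ w₂.2.1)
    (hT3 : ¬ ∃ z : Fin n → Bool, (∀ j ∈ J₀, I.eval z j = y j) ∧ gval I w₁.1 w₁.2.1 z = w₁.2.2 ∧ gval I w₂.1 w₂.2.1 z = w₂.2.2)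
    (hM0 : ∀ f ∈ J₀, ∃ z : Fin n → Bool, (∀ j ∈ J₀.erase f, I.eval z j = y j) ∧ gval I w₁.1 w₁.2.1 z = w₁.2.2 ∧ gval I w₂.1 w₂.2.1 z = w₂.2.2)
    {F : Finset (Fin m)} (hF : F ⊆ J₀) (hP : Peelable I F) (hmax : ∀ F', F ⊆ F' → F' ⊆ J₀ → Peelable I F' → F' = F)
    (hchord : ∀ e ∈ J₀ \ F, IsChord I J₀ e)
    (hcross : ∀ g ∈ w₁.2.1 ∪ w₂.2.1, ¬ (I.vars g 2 ∈ privs I (J₀ \ F) ∧ I.vars g 3 ∈ privs I (J₀ \ F))) :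
    ∃ B : BridgeData n m, B.y = y ∧ B.J₀ = J₀ ∧ B.N = J₀ \ F ∧ HasConstraints B w₁ w₂ ∧ B.WF I ∧ Lift I B ∧
      (sys I B).Infeasible B.N ∧ ∀ e ∈ B.N, (sys I B).ChordMinimal B.N e := by
  classical
  have hFN : J₀ \ (J₀ \ F) = F := Finset.sdiff_sdiff_eq_self hF
  -- fundamental sets
  have hfund : ∀ e, ∃ D : Finset (Fin m), e ∈ J₀ \ F → D ⊆ F ∧ e ∉ D ∧ ∀ w, Even (xpdeg I (insert e D) w) := by
    intro e
    by_cases he : e ∈ J₀ \ F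
    · obtain ⟨D, hD, heD, hev⟩ := exists_fundamental_of_maximal I hI hF hP hmax he
      exact ⟨D, fun _ => ⟨hD, heD, hev⟩⟩
    · exact ⟨∅, fun h => absurd h he⟩
  choose D hD using hfund
  -- chains for every output of `J₀`, inside `F`
  have hconn : ∀ e ∈ J₀, Relation.ReflTransGen (fun x y => ∃ j ∈ F, x ∈ xpair I j ∧ y ∈ xpair I j) (I.vars e 0) (I.vars e 1) := by
    intro e he
    by_cases heF : e ∈ F
    · exact Relation.ReflTransGen.single ⟨e, heF, (mem_xpair I).2 (Or.inl rfl), (mem_xpair I).2 (Or.inr rfl)⟩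
    · have he' : e ∈ J₀ \ F := mem_sdiff.2 ⟨he, heF⟩
      obtain ⟨hDF, heD, hev⟩ := hD e he'
      exact reflTransGen_mono I hDF (ends_connected_of_even I hI heD hev)
  -- joins
  obtain ⟨⟨T₁, hT₁F, hT₁⟩, ⟨T₂, hT₂F, hT₂⟩⟩ :=
    exists_join_of_terminal I hI hT hS hB y hne hr hG₁ hG₂ hT3 hM0 (F := F) hconn
  -- the data
  let B : BridgeData n m :=
    { y := y, J₀ := J₀, N := J₀ \ F, D := D, C₁ := w₁.1, G₁ := w₁.2.1, b₁ := w₁.2.2, T₁ := T₁,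
      C₂ := w₂.1, G₂ := w₂.2.1, b₂ := w₂.2.2, T₂ := T₂ }
  have hW : B.WF I :=
    { hN := sdiff_subset
      hchord := hchord
      hD := fun e he => by show D e ⊆ J₀ \ (J₀ \ F); rw [hFN]; exact (hD e he).1
      hDeven := fun e he => (hD e he).2.2
      hT₁ := by show T₁ ⊆ J₀ \ (J₀ \ F); rw [hFN]; exact hT₁F
      hT₂ := by show T₂ ⊆ J₀ \ (J₀ \ F); rw [hFN]; exact hT₂F
      hjoin₁ := fun w => by show Odd (xpdeg I T₁ w) ↔ w ∈ w₁.1 ∧ w ∈ xverts I (J₀ \ (J₀ \ F)); rw [hFN]; exact hT₁ w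
      hjoin₂ := fun w => by show Odd (xpdeg I T₂ w) ↔ w ∈ w₂.1 ∧ w ∈ xverts I (J₀ \ (J₀ \ F)); rw [hFN]; exact hT₂ w
      hcross₁ := fun g hg => hcross g (mem_union_left _ hg)
      hcross₂ := fun g hg => hcross g (mem_union_right _ hg) }
  have hL : Lift I B := lift_of_wf_peelable I hI hT B (by show Peelable I (J₀ \ (J₀ \ F)); rw [hFN]; exact hP)
  have hT3' : ¬ ∃ z, Solution I B B.J₀ z := fun ⟨z, hz⟩ => hT3 ⟨z, hz⟩
  have hinf : (sys I B).Infeasible B.N := infeasible_of_not_solution I hI hT hW hL hT3'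
  have hmin : ∀ e ∈ B.N, (sys I B).ChordMinimal B.N e := fun e he => by
    obtain ⟨z, hz⟩ := hM0 e (sdiff_subset he)
    exact chordMinimal_of_solution_erase I hI hT hW he hz
  exact ⟨B, rfl, rfl, rfl, ⟨rfl, rfl, rfl, rfl, rfl, rfl⟩, hW, hL, hinf, hmin⟩

end Summit.PneNP.PneNP.Theorems.PstarChordBridgeAssemble
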